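import Summits.HodgeConjecture.HodgeConjecture.Theorems.CyclicUnitaryPowersBlockScalars
import Summits.HodgeConjecture.HodgeConjecture.Theorems.CyclicUnitaryPowersCommutatorBootstrap
import Literature.AlgebraicGeometry.Motives.EtaleTate

/-!
# The connected deck-unitary group `U⁰(K)`: Cayley-reachable elements generate it (`Ω · Ω ⊇ U⁰`)

Helper for stub D₂ `stub_deckUnitaryCommutatorGeneration` of the crux `PowersHodgeOfDeckCommutators`
(stmt-HodgeConjecture-19545, route `CyclicUnitaryPowers`, line `unitary-kunneth-fft` v5, lane 2), step (b) of
the plan in HOME/HANDOFF § hodge-nonav-prover-Bx.  Over a field `K` of characteristic zero containing a primitive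
`p`-th root `ζ`, for an endomorphism `σ` of a finite-dimensional `W` with `σ ^ p = 1` (`p` odd) and a `σ`-invariant
bilinear form `B`:

* `centIso σ B` — the subgroup `U⁰(K) ≤ GL(W)` of automorphisms commuting with `σ`, preserving `B` and fixing
  the `σ`-fixed vectors;
* `cayleyReachable σ B` (`Ω`) — its subset `det (γ + 1) ≠ 0`; it is conjugation-stable
  (`conj_mem_cayleyReachable`);
* the block scalars `g_λ` (`blockUnit`): elements of `U⁰(K)` acting by `1, λ, …, λ, λ⁻¹, …, λ⁻¹` on the
  eigenspaces `E_0, E_1, …, E_h, E_{h+1}, …, E_{p-1}` (`blockUnit_mem_centIso`);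
* `det_smul_one_add_ne_zero_of_not_mem` — `det (c • 1 + N) = 0` only for the finitely many roots of the
  characteristic polynomial of `-N`;
* **`exists_mul_eq_of_mem_centIso`** — every `M ∈ U⁰(K)` is `a * b` with `a, b ∈ Ω`;
* **`commutator_mem_of_cayleyReachable`** — a subgroup containing the commutators of elements of `Ω` contains
  every commutator of `U⁰(K)` (with `CyclicUnitaryPowersCommutatorBootstrap.commutator_mem_of_mul_cover`).
-/

noncomputable section

open Module
open scoped BigOperators

namespace Summit.HodgeConjecture.HodgeConjecture.Theorems.CyclicUnitaryPowersDeckUnitaryGroup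

open Summit.HodgeConjecture.HodgeConjecture.Theorems.CyclicUnitaryPowersSpectralProjectors
open Summit.HodgeConjecture.HodgeConjecture.Theorems.CyclicUnitaryPowersBlockScalars
open Summit.HodgeConjecture.HodgeConjecture.Theorems.CyclicUnitaryPowersCommutatorBootstrap

variable {K : Type*} [Field K] {W : Type*} [AddCommGroup W] [Module K W]

/-! ### §1 The group `U⁰(K)` and its Cayley-reachable part `Ω` -/

/-- `U⁰(K)`: automorphisms commuting with `σ`, preserving `B`, fixing the `σ`-fixed vectors. [folklore] -/
def centIso (σ : W →ₗ[K] W) (B : LinearMap.BilinForm K W) : Subgroup (W ≃ₗ[K] W) where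
  carrier := {γ | (∀ x, γ (σ x) = σ (γ x)) ∧ (∀ x y, B (γ x) (γ y) = B x y) ∧ (∀ x, σ x = x → γ x = x)}
  one_mem' := ⟨fun _ => rfl, fun _ _ => rfl, fun _ _ => rfl⟩
  mul_mem' {γ δ} hγ hδ := by
    refine ⟨fun x => ?_, fun x y => ?_, fun x hx => ?_⟩
    · rw [LinearEquiv.mul_apply, LinearEquiv.mul_apply, hδ.1, hγ.1]
    · rw [LinearEquiv.mul_apply, LinearEquiv.mul_apply, hγ.2.1, hδ.2.1]
    · rw [LinearEquiv.mul_apply, hδ.2.2 x hx, hγ.2.2 x hx]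
  inv_mem' {γ} hγ := by
    refine ⟨fun x => ?_, fun x y => ?_, fun x hx => ?_⟩
    · rw [LinearEquiv.coe_inv]
      apply γ.injective
      rw [γ.apply_symm_apply, hγ.1, γ.apply_symm_apply]
    · rw [LinearEquiv.coe_inv]
      have h := hγ.2.1 (γ.symm x) (γ.symm y)
      rw [γ.apply_symm_apply, γ.apply_symm_apply] at h
      exact h.symm
    · rw [LinearEquiv.coe_inv]
      apply γ.injective
      rw [γ.apply_symm_apply, hγ.2.2 x hx]

/-- Membership in `U⁰(K)`. [folklore] -/
theorem mem_centIso_iff {σ : W →ₗ[K] W} {B : LinearMap.BilinForm K W} (γ : W ≃ₗ[K] W) :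
    γ ∈ centIso σ B ↔
      (∀ x, γ (σ x) = σ (γ x)) ∧ (∀ x y, B (γ x) (γ y) = B x y) ∧ (∀ x, σ x = x → γ x = x) :=
  Iff.rfl

/-- `Ω`: the Cayley-reachable part `det (γ + 1) ≠ 0` of `U⁰(K)`. [cite: GoodmanWallachGTM255, §2.2.3 Exercise 1] -/
def cayleyReachable (σ : W →ₗ[K] W) (B : LinearMap.BilinForm K W) : Set (W ≃ₗ[K] W) :=
  {γ | γ ∈ centIso σ B ∧ IsUnit (LinearMap.det ((γ : W →ₗ[K] W) + 1))}

/-- `Ω ⊆ U⁰(K)`. [folklore] -/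
theorem cayleyReachable_subset (σ : W →ₗ[K] W) (B : LinearMap.BilinForm K W) :
    cayleyReachable σ B ⊆ centIso σ B := fun _ h => h.1

/-- `Ω` is stable under conjugation by `U⁰(K)` (indeed by `GL(W)`: `det (h γ h⁻¹ + 1) = det (γ + 1)`).
[cite: GoodmanWallachGTM255, §2.2.3 Exercise 1 (b)] -/
theorem conj_mem_cayleyReachable {σ : W →ₗ[K] W} {B : LinearMap.BilinForm K W} {h γ : W ≃ₗ[K] W}
    (hh : h ∈ centIso σ B) (hγ : γ ∈ cayleyReachable σ B) : h * γ * h⁻¹ ∈ cayleyReachable σ B := by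
  refine ⟨(centIso σ B).mul_mem ((centIso σ B).mul_mem hh hγ.1) ((centIso σ B).inv_mem hh), ?_⟩
  have e : ((h * γ * h⁻¹ : W ≃ₗ[K] W) : W →ₗ[K] W) + 1 =
      (h : W →ₗ[K] W) ∘ₗ ((γ : W →ₗ[K] W) + 1) ∘ₗ (h.symm : W →ₗ[K] W) := by
    ext x
    simp only [LinearMap.add_apply, LinearEquiv.coe_coe, LinearEquiv.mul_apply, Module.End.one_apply,
      LinearMap.comp_apply, map_add, LinearEquiv.apply_symm_apply]
    rfl
  rw [e, LinearMap.det_conj]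
  exact hγ.2

/-- **Bootstrapping inside `U⁰(K)`**: a subgroup containing `[a, b]` for `a, b ∈ Ω` contains `[g, h]` for all
`g, h ∈ U⁰(K)`, PROVIDED `Ω · Ω ⊇ U⁰(K)`. [folklore] -/
theorem commutator_mem_of_cayleyReachable_of_cover {σ : W →ₗ[K] W} {B : LinearMap.BilinForm K W}
    (S : Subgroup (W ≃ₗ[K] W))
    (hcover : ∀ h ∈ centIso σ B, ∃ a ∈ cayleyReachable σ B, ∃ b ∈ cayleyReachable σ B, h = a * b)
    (hS : ∀ a ∈ cayleyReachable σ B, ∀ b ∈ cayleyReachable σ B, a * b * a⁻¹ * b⁻¹ ∈ S) {g h : W ≃ₗ[K] W}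
    (hg : g ∈ centIso σ B) (hh : h ∈ centIso σ B) : g * h * g⁻¹ * h⁻¹ ∈ S :=
  commutator_mem_of_mul_cover S (centIso σ B) (cayleyReachable σ B) (cayleyReachable_subset σ B)
    (fun _ hh' _ ha => conj_mem_cayleyReachable hh' ha) hcover hS hg hh

/-! ### §2 Roots: `det (c • 1 + N) = 0` only for finitely many `c` -/

section Roots

open scoped Classical

variable [FiniteDimensional K W]

/-- The finite set of `c` with `det (c • 1 + N) = 0`: the roots of the characteristic polynomial of `-[N]`.
[folklore] -/
def badScalars (N : Module.End K W) : Finset K :=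
  (-(LinearMap.toMatrix (Module.finBasis K W) (Module.finBasis K W) N)).charpoly.roots.toFinset

/-- `det (c • 1 + N) = 0 ⟹ c ∈ badScalars N`. [folklore] -/
theorem mem_badScalars_of_det_eq_zero (N : Module.End K W) {c : K}
    (h : LinearMap.det (c • (1 : Module.End K W) + N) = 0) : c ∈ badScalars N := by
  set b := Module.finBasis K W with hb
  set A := LinearMap.toMatrix b b N with hA
  have hdet : LinearMap.det (c • (1 : Module.End K W) + N) = (Matrix.scalar _ c - (-A)).det := by
    rw [← LinearMap.det_toMatrix b, map_add, map_smul, show (1 : Module.End K W) = LinearMap.id from rfl,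
      LinearMap.toMatrix_id, sub_neg_eq_add, Matrix.scalar_apply, ← Matrix.smul_one_eq_diagonal]
  rw [badScalars, Multiset.mem_toFinset, Polynomial.mem_roots (Matrix.charpoly_monic _).ne_zero, Polynomial.IsRoot,
    Matrix.eval_charpoly, ← hdet, h]

end Roots

/-! ### §3 The block units `g_λ` -/

section BlockUnits

variable [CharZero K] {σ : W →ₗ[K] W} {ζ : K} {p : ℕ}

/-- The scalars `(1, λ, …, λ, λ⁻¹, …, λ⁻¹)` on the eigenspaces `E_0, E_1, …, E_{p/2}, E_{p/2+1}, …, E_{p-1}`. [folklore] -/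
def unitScalars (p : ℕ) (c : K) : ℕ → K := fun j => if j = 0 then 1 else if j ≤ p / 2 then c else c⁻¹

omit [CharZero K] in
/-- `unitScalars p c j * unitScalars p c⁻¹ j = 1` (`c ≠ 0`). [folklore] -/
theorem unitScalars_mul_inv {c : K} (hc : c ≠ 0) (j : ℕ) : unitScalars p c j * unitScalars p c⁻¹ j = 1 := by
  unfold unitScalars
  split_ifs <;> simp [hc]

omit [CharZero K] in
/-- `unitScalars p c j * unitScalars p c (p - j) = 1` for `0 < j < p`, `p` odd, `c ≠ 0`. [folklore] -/
theorem unitScalars_mul_rev (hodd : Odd p) {c : K} (hc : c ≠ 0) {j : ℕ} (hj0 : 0 < j) (hjp : j < p) :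
    unitScalars p c j * unitScalars p c (p - j) = 1 := by
  obtain ⟨m, rfl⟩ := hodd
  have hdiv : (2 * m + 1) / 2 = m := by omega
  unfold unitScalars
  rw [hdiv]
  have h1 : j ≠ 0 := by omega
  have h2 : 2 * m + 1 - j ≠ 0 := by omega
  by_cases hjm : j ≤ m
  · have h3 : ¬ (2 * m + 1 - j ≤ m) := by omega
    simp [h1, h2, hjm, h3, hc]
  · have h3 : 2 * m + 1 - j ≤ m := by omega
    simp [h1, h2, hjm, h3, hc]

omit [CharZero K] in
/-- Block scalars are additive in the scalars. [folklore] -/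
theorem blockScalar_add (c c' : ℕ → K) :
    blockScalar σ ζ p c + blockScalar σ ζ p c' = blockScalar σ ζ p (fun j => c j + c' j) := by
  rw [blockScalar_def, blockScalar_def, blockScalar_def, ← Finset.sum_add_distrib]
  exact Finset.sum_congr rfl fun j _ => by rw [add_smul]

/-- **The block unit `g_λ`** as an automorphism (inverse `g_{λ⁻¹}`). [folklore] -/
def blockUnit (hσ : σ ^ p = 1) (hζ : IsPrimitiveRoot ζ p) (hp : 0 < p) {c : K} (hc : c ≠ 0) : W ≃ₗ[K] W :=
  LinearEquiv.ofLinear (blockScalar σ ζ p (unitScalars p c)) (blockScalar σ ζ p (unitScalars p c⁻¹))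
    (by
      change blockScalar σ ζ p (unitScalars p c) * blockScalar σ ζ p (unitScalars p c⁻¹) = (1 : Module.End K W)
      rw [blockScalar_mul hσ hζ hp, ← blockScalar_one (σ := σ) hζ hp]
      congr 1; funext j; exact unitScalars_mul_inv hc j)
    (by
      change blockScalar σ ζ p (unitScalars p c⁻¹) * blockScalar σ ζ p (unitScalars p c) = (1 : Module.End K W)
      rw [blockScalar_mul hσ hζ hp, ← blockScalar_one (σ := σ) hζ hp]
      congr 1; funext j; rw [mul_comm]; exact unitScalars_mul_inv hc j)

/-- The linear map underlying `g_λ`. [folklore] -/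
theorem coe_blockUnit (hσ : σ ^ p = 1) (hζ : IsPrimitiveRoot ζ p) (hp : 0 < p) {c : K} (hc : c ≠ 0) :
    ((blockUnit hσ hζ hp hc : W ≃ₗ[K] W) : W →ₗ[K] W) = blockScalar σ ζ p (unitScalars p c) := rfl

/-- `g_λ ∈ U⁰(K)` for a `σ`-invariant `B`, `p` odd. [folklore] -/
theorem blockUnit_mem_centIso (hσ : σ ^ p = 1) (hζ : IsPrimitiveRoot ζ p) (hp : 0 < p) (hodd : Odd p)
    {B : LinearMap.BilinForm K W} (hB : ∀ x y, B (σ x) (σ y) = B x y) {c : K} (hc : c ≠ 0) :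
    blockUnit hσ hζ hp hc ∈ centIso σ B := by
  refine ⟨fun x => ?_, fun x y => ?_, fun x hx => ?_⟩
  · change blockScalar σ ζ p (unitScalars p c) (σ x) = σ (blockScalar σ ζ p (unitScalars p c) x)
    rw [← Module.End.mul_apply, blockScalar_comm, Module.End.mul_apply]
  · exact blockScalar_isometry hσ hζ hp hB (unitScalars p c) (by simp [unitScalars])
      (fun j hj0 hjp => unitScalars_mul_rev hodd hc hj0 hjp) x y
  · exact blockScalar_apply_of_fixed hζ hp (unitScalars p c) (by simp [unitScalars]) hx

variable [FiniteDimensional K W]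

/-- `det` of a block scalar: `Π_{j<p} (c j) ^ dim E_j`. [folklore] -/
theorem det_blockScalar (hσ : σ ^ p = 1) (hζ : IsPrimitiveRoot ζ p) (hp : 0 < p) (c : ℕ → K) :
    LinearMap.det (blockScalar σ ζ p c) =
      ∏ j ∈ Finset.range p, c j ^ Module.finrank K (LinearMap.range (specProj σ ζ p j)) := by
  rw [det_eq_prod_det_block hσ hζ hp (blockScalar σ ζ p c) (blockScalar_comm c)]
  refine Finset.prod_congr rfl fun j hj => ?_
  rw [Module.End.mul_eq_comp, det_blockScalar_block hσ hζ hp c (Finset.mem_range.mp hj)]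

/-- `det (g_λ + 1) ≠ 0` when `λ ≠ -1` (and `λ ≠ 0`). [folklore] -/
theorem isUnit_det_blockUnit_add_one (hσ : σ ^ p = 1) (hζ : IsPrimitiveRoot ζ p) (hp : 0 < p) {c : K}
    (hc : c ≠ 0) (hc1 : c ≠ -1) :
    IsUnit (LinearMap.det (((blockUnit hσ hζ hp hc : W ≃ₗ[K] W) : W →ₗ[K] W) + 1)) := by
  rw [coe_blockUnit, ← blockScalar_one (σ := σ) hζ hp, blockScalar_add, det_blockScalar hσ hζ hp]
  rw [isUnit_iff_ne_zero, Finset.prod_ne_zero_iff]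
  intro j _
  apply pow_ne_zero
  unfold unitScalars
  have h2 : (1 : K) + 1 ≠ 0 := by norm_num
  have h3 : c + 1 ≠ 0 := fun h => hc1 (by linear_combination h)
  have h4 : c⁻¹ + 1 ≠ 0 := by
    intro h
    have : c⁻¹ = -1 := by linear_combination h
    exact hc1 (by rw [← inv_inv c, this, inv_neg, inv_one])
  split_ifs <;> [exact (by rw [add_comm]; exact h2); exact (by rw [add_comm] at h3 ⊢; exact h3);
    exact (by rw [add_comm] at h4 ⊢; exact h4)]

end BlockUnits

/-! ### §4 `Ω · Ω ⊇ U⁰(K)` -/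

section Cover

open scoped Classical

variable [CharZero K] {σ : W →ₗ[K] W} {ζ : K} {p : ℕ}

/-- The restriction to `E_j = range P_j` of `g_c + M` is `c j • id + M|_{E_j}`. [folklore] -/
theorem restrict_blockScalar_add (hσ : σ ^ p = 1) (hζ : IsPrimitiveRoot ζ p) (hp : 0 < p) (c : ℕ → K)
    (M : Module.End K W) (hM : M * σ = σ * M) {j : ℕ} (hj : j < p)
    (hf : ∀ x ∈ LinearMap.range (specProj σ ζ p j), (blockScalar σ ζ p c + M) x ∈ LinearMap.range (specProj σ ζ p j)) :
    (blockScalar σ ζ p c + M).restrict hf =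
      c j • (1 : Module.End K (LinearMap.range (specProj σ ζ p j))) +
        M.restrict (mapsTo_range_of_commute (commute_specProj (ζ := ζ) (p := p) M hM j)) := by
  ext ⟨x, hx⟩
  have hx' : x ∈ Module.End.eigenspace σ (ζ ^ j) := by rwa [range_specProj hσ hζ hp j] at hx
  simp only [LinearMap.coe_restrict_apply, LinearMap.add_apply, LinearMap.smul_apply, Module.End.one_apply,
    Submodule.coe_add, Submodule.coe_smul, blockScalar_apply_of_mem_eigenspace hζ hp c hj hx']

/-- On `E_0` (the `σ`-fixed vectors) an element of `U⁰(K)` restricts to the identity. [folklore] -/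
theorem restrict_eq_one_of_fixed (hσ : σ ^ p = 1) (hζ : IsPrimitiveRoot ζ p) (hp : 0 < p) (M : Module.End K W)
    (hM : M * σ = σ * M) (hfix : ∀ x, σ x = x → M x = x) :
    M.restrict (mapsTo_range_of_commute (commute_specProj (ζ := ζ) (p := p) M hM 0)) = 1 := by
  ext ⟨x, hx⟩
  have hx' : x ∈ Module.End.eigenspace σ (ζ ^ 0) := by rwa [range_specProj hσ hζ hp 0] at hx
  rw [Module.End.mem_eigenspace_iff, pow_zero, one_smul] at hx'
  simp only [LinearMap.coe_restrict_apply, Module.End.one_apply, hfix x hx']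

variable [FiniteDimensional K W]

/-- **`det (g_λ + M) ≠ 0` for `λ` outside a finite set.**  The bad set: `0`, `-1`, the bad scalars of the blocks
`M|_{E_j}` and their inverses. [folklore] -/
def badSet (σ : W →ₗ[K] W) (ζ : K) (p : ℕ) (M : Module.End K W) (hM : M * σ = σ * M) : Finset K :=
  {0, -1} ∪ (Finset.range p).biUnion fun j =>
    badScalars (M.restrict (mapsTo_range_of_commute (commute_specProj (ζ := ζ) (p := p) M hM j))) ∪
      (badScalars (M.restrict (mapsTo_range_of_commute (commute_specProj (ζ := ζ) (p := p) M hM j)))).image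
        (fun x => x⁻¹)

/-- For `λ ∉ badSet`, `det (g_λ + M) ≠ 0`. [folklore] -/
theorem det_blockUnit_add_ne_zero (hσ : σ ^ p = 1) (hζ : IsPrimitiveRoot ζ p) (hp : 0 < p) (M : Module.End K W)
    (hM : M * σ = σ * M) (hfix : ∀ x, σ x = x → M x = x) {c : K} (hc : c ∉ badSet σ ζ p M hM) :
    LinearMap.det (blockScalar σ ζ p (unitScalars p c) + M) ≠ 0 := by
  have hc0 : c ≠ 0 := fun h => hc (by rw [badSet, h]; simp)
  have hcomm : (blockScalar σ ζ p (unitScalars p c) + M) * σ = σ * (blockScalar σ ζ p (unitScalars p c) + M) := by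
    rw [add_mul, mul_add, blockScalar_comm, hM]
  rw [det_eq_prod_det_block hσ hζ hp _ hcomm, Finset.prod_ne_zero_iff]
  intro j hj
  have hj' := Finset.mem_range.mp hj
  rw [Module.End.mul_eq_comp, det_comp_specProj_add hσ hζ hp _ hcomm j,
    restrict_blockScalar_add hσ hζ hp _ M hM hj']
  by_cases hj0 : j = 0
  · subst hj0
    rw [restrict_eq_one_of_fixed hσ hζ hp M hM hfix]
    have e : unitScalars p c 0 • (1 : Module.End K (LinearMap.range (specProj σ ζ p 0))) + 1 =
        (2 : K) • (1 : Module.End K (LinearMap.range (specProj σ ζ p 0))) := by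
      simp only [unitScalars, if_true, one_smul]; rw [two_smul]
    rw [e, LinearMap.det_smul, show (1 : Module.End K (LinearMap.range (specProj σ ζ p 0))) = LinearMap.id from rfl,
      LinearMap.det_id, mul_one]
    exact pow_ne_zero _ two_ne_zero
  · intro hdet
    have hmem := mem_badScalars_of_det_eq_zero _ hdet
    apply hc
    rw [badSet, Finset.mem_union, Finset.mem_biUnion]
    refine Or.inr ⟨j, hj, ?_⟩
    rw [Finset.mem_union, Finset.mem_image]
    unfold unitScalars at hmem
    rw [if_neg hj0] at hmem
    by_cases hle : j ≤ p / 2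
    · rw [if_pos hle] at hmem; exact Or.inl hmem
    · rw [if_neg hle] at hmem; exact Or.inr ⟨c⁻¹, hmem, inv_inv c⟩

/-- **`Ω · Ω ⊇ U⁰(K)`**: every `M ∈ U⁰(K)` is a product of two Cayley-reachable elements
(`M = g_λ · (g_λ⁻¹ M)` for `λ` outside the finite bad set; `K` is infinite). [cite: GoodmanWallachGTM255, §2.2.3 Exercise 1] -/
theorem exists_mul_eq_of_mem_centIso (hσ : σ ^ p = 1) (hζ : IsPrimitiveRoot ζ p) (hp : 0 < p) (hodd : Odd p)
    {B : LinearMap.BilinForm K W} (hB : ∀ x y, B (σ x) (σ y) = B x y) {M : W ≃ₗ[K] W} (hM : M ∈ centIso σ B) :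
    ∃ a ∈ cayleyReachable σ B, ∃ b ∈ cayleyReachable σ B, M = a * b := by
  have hMσ : (M : W →ₗ[K] W) * σ = σ * (M : W →ₗ[K] W) := by
    ext x; exact hM.1 x
  obtain ⟨c, hc⟩ := Infinite.exists_notMem_finset (badSet σ ζ p (M : W →ₗ[K] W) hMσ)
  have hc0 : c ≠ 0 := fun h => hc (by rw [badSet, h]; simp)
  have hc1 : c ≠ -1 := fun h => hc (by rw [badSet, h]; simp)
  set g := blockUnit hσ hζ hp hc0 with hg
  have hgU : g ∈ centIso σ B := blockUnit_mem_centIso hσ hζ hp hodd hB hc0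
  refine ⟨g, ⟨hgU, isUnit_det_blockUnit_add_one hσ hζ hp hc0 hc1⟩, g⁻¹ * M,
    ⟨(centIso σ B).mul_mem ((centIso σ B).inv_mem hgU) hM, ?_⟩, (mul_inv_cancel_left g M).symm⟩
  -- `det (g⁻¹ M + 1) = det g⁻¹ · det (M + g) ≠ 0`
  have e : ((g⁻¹ * M : W ≃ₗ[K] W) : W →ₗ[K] W) + 1 =
      ((g⁻¹ : W ≃ₗ[K] W) : W →ₗ[K] W) * (blockScalar σ ζ p (unitScalars p c) + (M : W →ₗ[K] W)) := by
    rw [mul_add, ← coe_blockUnit hσ hζ hp hc0, ← hg, ← LinearEquiv.coe_toLinearMap_mul, ← LinearEquiv.coe_toLinearMap_mul,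
      inv_mul_cancel, LinearEquiv.coe_toLinearMap_one, add_comm]
    rfl
  rw [e, map_mul]
  exact (LinearEquiv.isUnit_det' _).mul
    (isUnit_iff_ne_zero.mpr (det_blockUnit_add_ne_zero hσ hζ hp _ hMσ (fun x hx => hM.2.2 x hx) hc))

/-- **All commutators of `U⁰(K)` lie in any subgroup containing the commutators of `Ω`.**
[cite: GoodmanWallachGTM255, §2.2.3 Exercise 1] -/
theorem commutator_mem_of_cayleyReachable (hσ : σ ^ p = 1) (hζ : IsPrimitiveRoot ζ p) (hp : 0 < p) (hodd : Odd p)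
    {B : LinearMap.BilinForm K W} (hB : ∀ x y, B (σ x) (σ y) = B x y) (S : Subgroup (W ≃ₗ[K] W))
    (hS : ∀ a ∈ cayleyReachable σ B, ∀ b ∈ cayleyReachable σ B, a * b * a⁻¹ * b⁻¹ ∈ S) {g h : W ≃ₗ[K] W}
    (hg : g ∈ centIso σ B) (hh : h ∈ centIso σ B) : g * h * g⁻¹ * h⁻¹ ∈ S :=
  commutator_mem_of_cayleyReachable_of_cover S
    (fun _ hM => exists_mul_eq_of_mem_centIso (ζ := ζ) hσ hζ hp hodd hB hM) hS hg hh

end Cover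


end Summit.HodgeConjecture.HodgeConjecture.Theorems.CyclicUnitaryPowersDeckUnitaryGroup

end
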